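import Literature.IUT.HodgeArakelov.CohomologySystemOfContH1
import Literature.AnabelianGeometry.EtaleTheta.KummerContH1Divisible

/-!
# Divisibility of Kummer classes IN THE LIMIT `lim_K H¹(H ⊓ K, A')` ([IUTchII] Prop. 1.4 / 2.2 (ii) shape)

Proof-only companion (abc-iut cell, seat abc-iut-w5-d125 gen 2, layer L6; 0 definitions, no named facts)
of abc-iut-L6-t1's `CohomologySystemOfContH1.lean` (the genuine limit `h1Lim φ A' H ⊥ = lim_K H¹(H ⊓ K, A')`
over the finite-index OPEN `K ≤ Π`, `h1Of`, `fmod`, `toLim`; [cite: Mochizuki2012, Prop 1.4 p.27] "`J` ranges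
over the finite index open subgroups of `Π`") and of L2's `KummerContH1Divisible.lean` (`κ(a)|_{H'} =
κ(x_N)^N` on any `H'` fixing the `N`-th root `x_N`, [cite: NeukirchSchmidtWingberg2008, I §5]).

WHAT IS PROVED (the mechanism behind the DIVISIBILITY of theta classes in
`lim_J H¹(Π_Ÿ(Π)|_J, (l·Δ_Θ)(Π))`, input `hdiv` of the [IUTchII] Prop. 2.2 (ii) "respectively" clause at the
model — consumer abc-iut-w4-d010; here for an ARBITRARY compatible root system `x` of an element `a` of a
`Π`-group `A` with open stabilisers and ANY change of coefficient cyclotome `c : Λ(A) → A'`, no divisibility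
of `A` assumed):
* `h1Of_kummerContClass_eq_nsmul` — for indices `i ≤ j` (`K_j ⊆ K_i`) with `H ⊓ K_j` fixing `x_N`: the image
  in the limit of the level-`K_i` Kummer class of `a` is `N •` the image of the level-`K_j` Kummer class of
  `x_N` (shifted root system);
* `exists_nsmul_eq_h1Of_kummerContClass` — hence that image is `N`-DIVISIBLE in the limit as soon as SOME
  finite-index open `K ⊆ K_i` has `H ⊓ K` fixing `x_N` (this finite-index open level is the one genuine
  input: in a tempered group an open stabiliser need not have finite index);
* `exists_nsmul_eq_toLim_kummerContClass` — the same for a class given at a finite-index open level `J`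
  through `H1 J ≅ H¹(H ⊓ J, A')` and `toLim J` (the form in which theta classes `θ(Π) ⊆ H¹(Π_Ÿ(Π), ·) = H1 ⊤`
  are pushed into the limit).
Claim key of the ambient interface `Mochizuki2012` (D-0012, disputed); the content is classical Kummer theory;
nothing here bears on [IUTchIII] Cor. 3.12; typed ≠ proved elsewhere, here everything is proved.
-/

namespace Literature.IUT.HodgeArakelov

open Literature.AnabelianGeometry.EtaleTheta CohomologySystemOfContH1

universe u

noncomputable section

namespace CohomologySystemOfContH1

variable {P : TopGroup.{u}} {G' : Type u} [Group G'] [TopologicalSpace G'] [IsTopologicalGroup G']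
  (φ : P →* G') (A' : Subgroup G') [A'.Normal] [IsMulCommutative A'] (H : Subgroup P)
  {A : Type*} [CommGroup A] [MulDistribMulAction P A] [TopologicalSpace A]
  (c : CyclotomeCoefficients φ A' A) (hA : ∀ b : A, IsOpen (MulAction.stabilizer P b : Set P))
  {a : A}

/-- **Level change multiplies by `N`.** For indices `i ≤ j` over `⊥` (i.e. `K_j ⊆ K_i`) such that `H ⊓ K_j`
fixes the `N`-th root `x_N`: in `lim_K H¹(H ⊓ K, A')` the level-`K_i` Kummer class of `a` equals `N •` the
level-`K_j` Kummer class of `x_N` (computed with the shifted root system `y_n = x_{nN}`).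
[cite: NeukirchSchmidtWingberg2008, I §5] -/
theorem h1Of_kummerContClass_eq_nsmul (x : RootSystem a) (N : ℕ+) {i j : Idx (P := P) ⊥} (hij : i ≤ j)
    (hai : a ∈ MulAction.fixedPoints ↥(H ⊓ i.K) A) (hNj : x.root N ∈ MulAction.fixedPoints ↥(H ⊓ j.K) A) :
    ∃ y : RootSystem (x.root N), (∀ n : ℕ+, y.root n = x.root (n * N)) ∧
      h1Of φ A' H ⊥ i (Additive.ofMul (c.kummerContClass (H ⊓ i.K) x hai fun _ => hA _)) =
        (N : ℕ) • h1Of φ A' H ⊥ j (Additive.ofMul (c.kummerContClass (H ⊓ j.K) y hNj fun _ => hA _)) := by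
  obtain ⟨y, hy, h⟩ :=
    c.exists_res_kummerContClass_eq_pow hA (inf_le_inf_left H (Idx.le_iff.mp hij)) x N hai hNj
  refine ⟨y, hy, ?_⟩
  rw [← h1Of_fmod φ A' H ⊥ hij, ← map_nsmul]
  -- `fmod i j (ofMul κ_x) = ofMul (res κ_x) = ofMul (κ_y ^ N) = N • ofMul κ_y`, i.e. `h` read additively
  exact congrArg (h1Of φ A' H ⊥ j) (congrArg Additive.ofMul h)

/-- **Divisibility in the limit.** If some finite-index OPEN `K ⊆ K_i` has `H ⊓ K` fixing the `N`-th root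
`x_N`, then the image in `lim_K H¹(H ⊓ K, A')` of the level-`K_i` Kummer class of `a` is `N`-divisible.
[cite: Mochizuki2012, Prop 1.4 p.27] -/
theorem exists_nsmul_eq_h1Of_kummerContClass (x : RootSystem a) (N : ℕ+) (i : Idx (P := P) ⊥)
    (hai : a ∈ MulAction.fixedPoints ↥(H ⊓ i.K) A) (K : Subgroup P) (hK : K.FiniteIndex)
    (hKo : IsOpen (K : Set P)) (hKi : K ≤ i.K) (hNK : x.root N ∈ MulAction.fixedPoints ↥(H ⊓ K) A) :
    ∃ z : h1Lim φ A' H ⊥,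
      (N : ℕ) • z = h1Of φ A' H ⊥ i (Additive.ofMul (c.kummerContClass (H ⊓ i.K) x hai fun _ => hA _)) := by
  let j : Idx (P := P) ⊥ := OrderDual.toDual ⟨K, hK, hKo, bot_le⟩
  have hij : i ≤ j := Idx.le_iff.mpr hKi
  obtain ⟨y, -, h⟩ := h1Of_kummerContClass_eq_nsmul φ A' H c hA x N hij hai hNK
  exact ⟨_, h.symm⟩

/-- **Divisibility in the limit, for a class given at a finite-index open level `J`** (e.g. `J = ⊤`:
"`θ(Π) ⊆ H¹(Π_Ÿ(Π), ·)`" pushed into "`lim_J H¹(Π_Ÿ(Π)|_J, ·)`" by `toLim`): if some finite-index open `K ⊆ J`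
has `H ⊓ K` fixing `x_N`, then `toLim J` of the Kummer class of `a` in `H¹(H ⊓ J, A') ≅ H1 J` is `N`-divisible
in the limit. [cite: Mochizuki2012, Prop 1.4 p.27] -/
theorem exists_nsmul_eq_toLim_kummerContClass (x : RootSystem a) (N : ℕ+) (J : Subgroup P)
    (hJ : J.FiniteIndex) (hJo : IsOpen (J : Set P)) (haJ : a ∈ MulAction.fixedPoints ↥(H ⊓ J) A)
    (K : Subgroup P) (hK : K.FiniteIndex) (hKo : IsOpen (K : Set P)) (hKJ : K ≤ J)
    (hNK : x.root N ∈ MulAction.fixedPoints ↥(H ⊓ K) A) :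
    ∃ z : h1Lim φ A' H ⊥,
      (N : ℕ) • z = (cohomologySystemOfContH1 φ A' H).toLim J
        ((h1EquivOfFiniteIndexOpen φ A' H J hJ hJo).symm
          (Additive.ofMul (c.kummerContClass (H ⊓ J) x haJ fun _ => hA _))) := by
  rw [toLim_h1Equiv_symm]
  exact exists_nsmul_eq_h1Of_kummerContClass φ A' H c hA x N ((Idx.self J hJ hJo).incl bot_le) haJ K hK
    hKo hKJ hNK

end CohomologySystemOfContH1

end

end Literature.IUT.HodgeArakelov
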